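import Summits.QuantumFields.YangMills.Theorems.UnitScaleTiltProp7FlatSubsolutionCaccioppoli
import Summits.QuantumFields.YangMills.Theorems.UnitScaleTiltProp7FlatFaberKrahnZd
import HarnessLib

/-!
# Route R of crux K1 «MinimiserStabilityRegPr» (stmt-QuantumFields-19200) — ONE STEP OF DE GIORGI'S INTERIOR ITERATION FOR A NONNEGATIVE SUBSOLUTION OF
# THE LATTICE LAPLACIAN ON `ℤ^d`: raising the level by `δ` and shrinking the box by `s + 2` contracts the truncated mass, `U′ ≤ 416·d²·X²·U∕s²` whenever
# `Xᵈ ≥ 4U∕δ²` (file F2 of the sub-mean-value letter for subharmonic densities; cell `ym3-torus`, width seat `ym-ust-19200-w1` g6; ★★OWNER RULING g26-№20 GO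
# «generic brick»; `--supports stmt-QuantumFields-19200 --as helper`, count-neutral)

YM₃ on T³ is a RUNG of the ladder (R3), not the Clay problem; nothing here claims the stub, the crux or the gap.

WHY.  The sub-mean-value inequality for nonnegative discrete subharmonic functions (the generic brick behind route R's (JC′)∕(S3′) Kato densities) is De Giorgi's
iteration in its Faber–Krahn form; this is the `ℤ^d` twin of the cell's `Beta.DeGiorgiStep` (unit torus), assembled BY NAME from F1 (`Prop7FlatSubsolutionCaccioppoli`:
level truncation, cutoff Caccioppoli), the tree's cutoff (`B4Eq19LatticeCaccioppoli.exists_cutoff`), Chebyshev (`Beta.SubsolutionCaccioppoli.card_filter_mul_sq_le`) and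
the `ℤ^d` Faber–Krahn inequality (`Prop7FlatFaberKrahnZd.faberKrahn`, p612230).

WHAT IS PROVED (sorry-free, no definition).  `−Δz ≤ 0` on `Q_R(x₀)` (no sign condition: only truncations enter); radii `0 ≤ ρ − s − 2`, `1 ≤ s`, `ρ ≤ R`; a level `l` and an increment `δ > 0`;
`v = (z − l)₊`, `v′ = (z − l − δ)₊`, `U = Σ_{Q_ρ(x₀)} v²`, `U′ = Σ_{Q_{ρ−s−2}(x₀)} v′²`.
* `sum_sq_posPart_anti` (`Σ v′² ≤ Σ v²`), `card_super_le` (Chebyshev: `#{y ∈ Q_{ρ−2} : δ < v} ≤ U∕δ²`).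
* ★★ `step` — for ANY real `X ≥ 0` with `4U∕δ² ≤ Xᵈ`: **`U′ ≤ 416·d²·X²·U∕s²`** (if `X < 1` the super-level set is empty and `U′ = 0`; else tile side `⌈X⌉ ≤ 2X` in
  `faberKrahn` on `w = χ·v′`, `χ` the cutoff `1` on `Q_{ρ−s−1}`, `0` off `Q_{ρ−2}`, and `caccioppoli_sub_cutoff`: `Σ|∇w|² ≤ 26d·U∕s²`).

HONEST SCOPE.  [folklore] lattice analysis (De Giorgi 1957; the Faber–Krahn form of the iteration — method pointers only); F3 (the dyadic iteration and the sub-mean-value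
inequality with its torus pullback) is the next file.  Nothing of Bałaban's is asserted.

References: M. Giaquinta, Princeton UP 1983 [Giaquinta1984] (Ch. III §2); T. Bałaban, CMP 96 (1984) 223–250 [Balaban1984PropagatorsII] ((1.9) p.226).
-/

set_option autoImplicit false

noncomputable section

open scoped BigOperators
open Finset

namespace Summit.QuantumFields.YangMills.Theorems.Prop7FlatDeGiorgiStep

open Literature.MathematicalPhysics.QuantumFieldTheory.Balaban1983to89
open B4Eq19LatticeOperators B4Eq19LatticeCaccioppoli
open Summit.QuantumFields.YangMills.Theorems.Prop7FlatSubsolutionCaccioppoli (posPart_sub_subsolution caccioppoli_sub_cutoff posPart_anti)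
open Summit.QuantumFields.YangMills.Theorems.Prop7FlatFaberKrahnZd (faberKrahn)
open Summit.QuantumFields.BalabanUV.Beta.SubsolutionCaccioppoli (card_filter_mul_sq_le)

variable {d : ℕ}

/-- Raising the level lowers the truncated mass on any finset: `Σ_S (z − l′)₊² ≤ Σ_S (z − l)₊²` for `l ≤ l′`. [folklore] -/
theorem sum_sq_posPart_anti (S : Finset (Zd d)) (z : Zd d → ℝ) {l l' : ℝ} (hll : l ≤ l') :
    ∑ y ∈ S, max (z y - l') 0 ^ 2 ≤ ∑ y ∈ S, max (z y - l) 0 ^ 2 :=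
  Finset.sum_le_sum fun y _ => pow_le_pow_left₀ (le_max_right _ _) (posPart_anti z hll y) 2

/-- **Chebyshev for the truncation**: `#{y ∈ S : δ < (z − l)₊(y)}·δ² ≤ Σ_S (z − l)₊²`. [folklore] -/
theorem card_super_le (S : Finset (Zd d)) (z : Zd d → ℝ) (l : ℝ) {δ : ℝ} (hδ : 0 < δ) :
    ((S.filter fun y => δ < max (z y - l) 0).card : ℝ) * δ ^ 2 ≤ ∑ y ∈ S, max (z y - l) 0 ^ 2 :=
  card_filter_mul_sq_le S (fun y => max (z y - l) 0) hδ

/-- ★★ **ONE STEP OF DE GIORGI'S ITERATION ON `ℤ^d`.**  `−Δz ≤ 0` on `Q_R(x₀)`; `1 ≤ s`, `0 ≤ ρ − s − 2`, `ρ ≤ R`; level `l`, increment `δ > 0`;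
`U = Σ_{Q_ρ(x₀)} (z−l)₊²`, `U′ = Σ_{Q_{ρ−s−2}(x₀)} (z−l−δ)₊²`.  For every real `X ≥ 0` with `4U∕δ² ≤ Xᵈ`: `U′ ≤ 416·d²·X²·U∕s²`.
[folklore] [cite: Giaquinta1984, Ch. III §2 p.78] -/
theorem step (hd : 1 ≤ d) (z : Zd d → ℝ) (x₀ : Zd d) {R ρ s : ℤ} (hz : ∀ y ∈ box x₀ R, lop 0 z y ≤ 0)
    (hs : 1 ≤ s) (hρ : 0 ≤ ρ - s - 2) (hρR : ρ ≤ R) (l : ℝ) {δ : ℝ} (hδ : 0 < δ) {X : ℝ} (hX : 0 ≤ X)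
    (hU : 4 * (∑ y ∈ box x₀ ρ, max (z y - l) 0 ^ 2) / δ ^ 2 ≤ X ^ d) :
    ∑ y ∈ box x₀ (ρ - s - 2), max (z y - l - δ) 0 ^ 2 ≤
      416 * (d : ℝ) ^ 2 * X ^ 2 * (∑ y ∈ box x₀ ρ, max (z y - l) 0 ^ 2) / (s : ℝ) ^ 2 := by
  classical
  set v : Zd d → ℝ := fun y => max (z y - l) 0 with hv
  set v' : Zd d → ℝ := fun y => max (z y - l - δ) 0 with hv'
  set U := ∑ y ∈ box x₀ ρ, v y ^ 2 with hUdef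
  have hU0 : 0 ≤ U := Finset.sum_nonneg fun _ _ => sq_nonneg _
  have hs0 : (0 : ℝ) < s := by exact_mod_cast (show (0 : ℤ) < s by linarith)
  have hv'0 : ∀ y, 0 ≤ v' y := fun y => le_max_right _ _
  have hv'le : ∀ y, v' y ≤ v y := fun y => by
    simp only [hv, hv']
    exact max_le_max (by linarith) le_rfl
  have hv'sub : ∀ y ∈ box x₀ R, lop 0 v' y ≤ 0 := by
    have := posPart_sub_subsolution hz (l + δ)
    intro y hy
    have e : v' = (fun x => max (z x - (l + δ)) 0) := by funext x; simp only [hv', sub_sub]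
    rw [e]
    exact this y hy
  -- the super-level set where `w` can live
  set A := (box x₀ (ρ - 2)).filter fun y => δ < v y with hA
  have hAcount : (A.card : ℝ) * δ ^ 2 ≤ U := by
    calc (A.card : ℝ) * δ ^ 2 ≤ ∑ y ∈ box x₀ (ρ - 2), v y ^ 2 := card_super_le _ z l hδ
      _ ≤ U := Finset.sum_le_sum_of_subset_of_nonneg (box_mono x₀ (by linarith)) fun _ _ _ => sq_nonneg _
  have hAX : 4 * (A.card : ℝ) ≤ X ^ d := by
    have h1 : 4 * (A.card : ℝ) ≤ 4 * U / δ ^ 2 := by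
      rw [le_div_iff₀ (by positivity)]; nlinarith
    exact h1.trans hU
  -- the cutoff: `1` on `Q_{ρ−s−1}`, `0` off `Q_{ρ−2}`, slope `1/s`
  obtain ⟨χ, hχ0, hχ1, hχin, hχout, hχlip⟩ := exists_cutoff x₀ (ρ := ρ - s - 2) (s := s) hρ hs
  have hχout' : ∀ y ∉ box x₀ (ρ - 2), χ y = 0 := fun y hy => hχout y (by rwa [show ρ - s - 2 + s = ρ - 2 by ring])
  set w : Zd d → ℝ := fun y => χ y * v' y with hw
  -- `w ≠ 0 ⟹ y ∈ A`
  have hwA : ∀ y, w y ≠ 0 → y ∈ A := by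
    intro y hy
    have hχy : χ y ≠ 0 := fun h => hy (by simp [hw, h])
    have hyb : y ∈ box x₀ (ρ - 2) := by by_contra h; exact hχy (hχout' y h)
    have hv'y : v' y ≠ 0 := fun h => hy (by simp [hw, h])
    rw [hA, Finset.mem_filter]
    refine ⟨hyb, ?_⟩
    have : 0 < v' y := lt_of_le_of_ne (hv'0 y) (Ne.symm hv'y)
    simp only [hv', hv] at this ⊢
    have h2 : 0 < z y - l - δ := by
      by_contra hle; push Not at hle; rw [max_eq_right hle] at this; exact lt_irrefl _ this
    calc δ < z y - l := by linarith
      _ ≤ max (z y - l) 0 := le_max_left _ _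
  -- `U′ ≤ Σ_A w²`
  have hU'le : ∑ y ∈ box x₀ (ρ - s - 2), v' y ^ 2 ≤ ∑ y ∈ A, w y ^ 2 := by
    have h1 : ∑ y ∈ box x₀ (ρ - s - 2), v' y ^ 2 = ∑ y ∈ box x₀ (ρ - s - 2), w y ^ 2 := by
      refine Finset.sum_congr rfl fun y hy => ?_
      simp only [hw, hχin y (box_mono x₀ (by linarith) hy), one_mul]
    rw [h1, ← Finset.sum_filter_ne_zero (box x₀ (ρ - s - 2))]
    refine Finset.sum_le_sum_of_subset_of_nonneg (fun y hy => ?_) fun _ _ _ => sq_nonneg _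
    rw [Finset.mem_filter] at hy
    exact hwA y fun h => hy.2 (by rw [h]; ring)
  -- Caccioppoli: `Σ_{Q_{ρ−1}} |∇w|² ≤ 26d/s² · Σ_{Q_ρ} v'² ≤ 26d U/s²`
  have hCacc : ∑ y ∈ box x₀ (ρ - 1), ∑ μ, fdiff μ w y ^ 2 ≤ 26 * d / (s : ℝ) ^ 2 * U := by
    have hsubχ : ∀ y, χ y ≠ 0 → lop 0 v' y ≤ 0 := fun y hy => by
      have hyb : y ∈ box x₀ (ρ - 2) := by by_contra h; exact hy (hχout' y h)
      exact hv'sub y (box_mono x₀ (by linarith) hyb)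
    have hlip' : ∀ (y : Zd d) (μ : Fin d), |fdiff μ χ y| ≤ 1 / (s : ℝ) := fun y μ => by rw [fdiff_apply]; exact hχlip y μ
    have h := caccioppoli_sub_cutoff χ v' hv'0 x₀ (R := ρ - 1) (fun y hy => hχout' y (by rwa [show ρ - 1 - 1 = ρ - 2 by ring] at hy))
      hsubχ hs0 hlip'
    rw [show ρ - 1 + 1 = ρ by ring] at h
    have h2 : ∑ y ∈ box x₀ ρ, v' y ^ 2 ≤ U := Finset.sum_le_sum fun y _ => pow_le_pow_left₀ (hv'0 y) (hv'le y) 2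
    calc ∑ y ∈ box x₀ (ρ - 1), ∑ μ, fdiff μ w y ^ 2 ≤ 26 * d / (s : ℝ) ^ 2 * ∑ y ∈ box x₀ ρ, v' y ^ 2 := h
      _ ≤ 26 * d / (s : ℝ) ^ 2 * U := mul_le_mul_of_nonneg_left h2 (by positivity)
  -- case `X < 1`: the super-level set is empty
  by_cases hX1 : X < 1
  · have hAempty : A.card = 0 := by
      have h1 : X ^ d < 1 := pow_lt_one₀ hX hX1 (by omega)
      have h2 : 4 * (A.card : ℝ) < 1 := lt_of_le_of_lt hAX h1
      have : (A.card : ℝ) < 1 := by linarith [Nat.cast_nonneg (α := ℝ) A.card]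
      exact Nat.lt_one_iff.mp (by exact_mod_cast this)
    have hA0 : A = ∅ := Finset.card_eq_zero.mp hAempty
    have : ∑ y ∈ box x₀ (ρ - s - 2), v' y ^ 2 ≤ 0 := by
      calc ∑ y ∈ box x₀ (ρ - s - 2), v' y ^ 2 ≤ ∑ y ∈ A, w y ^ 2 := hU'le
        _ = 0 := by rw [hA0, Finset.sum_empty]
    have hR0 : 0 ≤ 416 * (d : ℝ) ^ 2 * X ^ 2 * U / (s : ℝ) ^ 2 := by positivity
    exact this.trans hR0
  · -- case `X ≥ 1`: tile side `⌈X⌉ ≤ 2X`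
    push Not at hX1
    set r : ℕ := ⌈X⌉₊ with hr
    have hr1 : 1 ≤ r := Nat.one_le_iff_ne_zero.mpr (by rw [hr]; exact Nat.pos_iff_ne_zero.mp (Nat.ceil_pos.mpr (by linarith)))
    have hrX : (r : ℝ) ≤ 2 * X := by
      have := Nat.ceil_lt_add_one hX
      rw [← hr] at this; linarith
    have hXr : X ≤ (r : ℝ) := Nat.le_ceil X
    have hAr : 4 * A.card ≤ r ^ d := by
      have : (4 : ℝ) * A.card ≤ (r : ℝ) ^ d := hAX.trans (pow_le_pow_left₀ hX hXr d)
      exact_mod_cast this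
    -- Faber–Krahn on `w`, support `A`, differences inside `Q_{ρ−1}`
    have hT : ∀ (y : Zd d) (i : Fin d), fdiff i w y ≠ 0 → y ∈ box x₀ (ρ - 1) := by
      intro y i hy
      have : w y ≠ 0 ∨ w (y + unitVec i) ≠ 0 := by
        by_contra hb; push Not at hb; exact hy (by rw [fdiff_apply, hb.1, hb.2, sub_zero])
      rcases this with h0 | h0
      · have := (Finset.mem_filter.mp (hwA _ h0)).1
        exact box_mono x₀ (by linarith) this
      · have hm := (Finset.mem_filter.mp (hwA _ h0)).1
        have := sub_unitVec_mem_box hm i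
        simp only [add_sub_cancel_right] at this
        exact box_mono x₀ (by linarith) this
    have hFK := faberKrahn (f := w) (S := A) (T := box x₀ (ρ - 1)) hwA hT hr1 hAr
    have hcoef : 4 * ((d : ℝ) * r * ((r : ℝ) - 1)) ≤ 16 * d * X ^ 2 := by
      have hd0 : (0 : ℝ) ≤ d := Nat.cast_nonneg d
      have : (r : ℝ) * ((r : ℝ) - 1) ≤ 4 * X ^ 2 := by nlinarith
      nlinarith
    have hE0 : 0 ≤ ∑ y ∈ box x₀ (ρ - 1), ∑ μ, fdiff μ w y ^ 2 := Finset.sum_nonneg fun _ _ => Finset.sum_nonneg fun _ _ => sq_nonneg _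
    calc ∑ y ∈ box x₀ (ρ - s - 2), v' y ^ 2 ≤ ∑ y ∈ A, w y ^ 2 := hU'le
      _ ≤ 4 * ((d : ℝ) * r * ((r : ℝ) - 1)) * ∑ y ∈ box x₀ (ρ - 1), ∑ μ, fdiff μ w y ^ 2 := hFK
      _ ≤ 16 * d * X ^ 2 * ∑ y ∈ box x₀ (ρ - 1), ∑ μ, fdiff μ w y ^ 2 := mul_le_mul_of_nonneg_right hcoef hE0
      _ ≤ 16 * d * X ^ 2 * (26 * d / (s : ℝ) ^ 2 * U) := mul_le_mul_of_nonneg_left hCacc (by positivity)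
      _ = 416 * (d : ℝ) ^ 2 * X ^ 2 * U / (s : ℝ) ^ 2 := by ring

end Summit.QuantumFields.YangMills.Theorems.Prop7FlatDeGiorgiStep

end
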